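import Summits.QuantumFields.BalabanUV.Gaps.BetaContFromD4Chain
import Literature.MathematicalPhysics.QuantumFieldTheory.Balaban1983to89.Node00.BetaOfRecord

/-!
# DAG node N26 — binder B4 «β-continuity» AT THE β-FUNCTIONS OF RECORD (NODE 00 Stage ₈, part β:
# `Node00.betaOfTerms F ℰ⁰ ℰ¹ ρ bV γ` ∕ `Node00.betaOfMerged βm β⁰ γ`): what B4 IS there, the rows-(D4) ∧ B4 residue
# `AtSlopeCont` for the record's DEFINITIONAL one-loop split from NAMED located inputs, and the chain-free M-test road

Cell `pub-ymgap`, YM-PLAN Track A (HUMAN RULING D-0062), seat `pub-ymgap-dag-n26-a` (gen 2; -a = KNIT-BY-NAME), ROSTER-D0062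
RE-POINT «n26: the (D4)-chain instance for D₀ by name».  Companion of `BalabanUVNodesN26BetaCont` (gen 0: N26 at an ABSTRACT
datum from one `ChainTFac190H` inhabitant for a split of `D.βfun`).  Since then NODE 00's Stage ₈ (part β) typed the β-FUNCTIONS
OF RECORD as TOTAL DEFINITIONS of the term families of the effective action (`Node00.BetaOfRecord`, [I] (1.20)–(1.22) p. 264):
`betaOfTerms F ℰ⁰ ℰ¹ ρ bV γ k p = β⁰_{k+1} + 𝟙_{]0,γ]^{k+1}}(p)·β¹_{k+1}(p)`, `β¹_{k+1}(p) = Σ_z Π¹_{k+1}(p; z) z₀z₁`, `Π¹_{k+1}(p; ·) =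
polLimit F (k+1) (ℰ¹ k p ·) ρ bV` the `K → ∞` limit (1.21) of the finite-volume polarisation kernels of the REMAINDER family `ℰ¹`
at the history `p`; the one-loop split `oneLoopSplit_betaOfTerms` holds BY CONSTRUCTION.  This file says what N26 costs AT THAT
β; every theorem is about the `HBeta` itself, so it instantiates at `D₀` by `rfl` once Stage ₈ (a)–(c) pins `D₀.βfun :=
betaOfTerms …` (and through gen 0's datum-level glue `n26_of_atSlopeCont` verbatim).

WHAT IS HERE (compositions of tree theorems BY NAME; no definition, no restatement, 0 `sorry`):
* §1 WHAT B4 IS AT THE RECORD'S β: on every box `γc ≤ γ`, `BetaContH γc (betaOfTerms …)` ⇔ continuity in the history of the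
  remainder's second moment `p ↦ Σ_z Π¹_{k+1}(p; z) z₀z₁` (`betaContH_betaOfTerms_iff`; β⁰ is history-free BY TYPING); design (β):
  `BetaContH γc (betaOfMerged βm β⁰ γ)` ⇔ continuity of the merged `βm` on the box (`betaContH_betaOfMerged_iff`); N26's literal
  at the record ⇔ the same on SOME box `0 < γc ≤ γ` (`n26lit_betaOfTerms_iff`).  So at `D₀` B4 is a statement about the
  thermodynamic-limit polarisation kernel of ℰ¹ — NO bound-type clause supplies it (dag-ref-D ERRATUM E-1 ∕ READ-CARDS v0.14).
* §2 THE CHAIN-FREE ROAD (Weierstrass M-test, `Beta.BetaContinuity.continuousOn_secondMoment` BY NAME): B4 at the record's β on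
  the box `γc ≤ γ` ⇐ (C-pt) TERMWISE continuity `p ↦ Π¹_{k+1}(p; z)` on the box for every site `z` + the (5.10) decay of
  `Π¹_{k+1}(p; ·)` with constants uniform in `p` on the box, per scale (`betaContH_betaOfTerms_of_kernel`; N26's literal
  `n26lit_betaOfTerms_of_kernel`; design (β) twin `betaContH_betaOfMerged_of_kernel` — there the decay clause is the PRINTED
  (5.10) p. 293 for the full kernel, uniform in the suppressed history).
* §3 THE ROWS-(D4) ∧ B4 RESIDUE AT THE RECORD'S SPLIT — «the (D4)-chain instance for D₀ BY NAME»: given the (1.7)-leaf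
  kernels `A1 k p : LDom 4 → Pt 4 → ℝ`, the LOCALIZED REPRESENTATION OF THE LIMIT KERNEL `Π¹_{k+1}(p; z) = Σ'_Y A¹_{k+1}(p; Y, z)`
  on the box ([I] p. 264: «This limit exists by the localized representation (1.7)»; hypothesis `hrep`), the [II]-(2.38) ∕ (190)
  ∕ (1.7) leaves `PolLeavesTFac190H 4 M (A1 k p) c ℓ α₂ q` on the box (`hleaves`), the numeric side conditions and (C-pt), the
  record's DEFINITIONAL split `oneLoopSplit_betaOfTerms` carries `AtSlopeCont … γ₀ s` (`atSlopeCont_betaOfTerms`: the chain's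
  field `beta1_eq` is DISCHARGED by the Stage-₈ definition + `hrep`; `leaves` := `hleaves`; `CPt` := (C-pt) through `hrep`),
  hence B4 on the box `γ₀` and N26's literal (`betaContH_betaOfTerms_of_localizedRep`, `n26lit_betaOfTerms_of_localizedRep`,
  `Gaps.BetaContFromD4Chain.betaContH_of_chainTFac190H` BY NAME), and the wall's constant form `RemainderConst` at the record's
  split (`remainderConst_betaOfTerms_of_localizedRep`).  For Bałaban's `ℰ¹` the inputs `A1 ∕ hrep ∕ hleaves` are NODE O's
  objects and theorems — INSTANCE 0∕1 (GAPS v1.0 §B row (D4)); nothing is discharged here.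
* §4 (C-pt) OF THE LIMIT KERNEL FROM FINITE VOLUME ([folklore]): if the windowed finite-volume kernels `K ↦ polWindow F K j
  (ℰ x K) ρ bV μ ν z` converge UNIFORMLY on a parameter set `s` and are eventually continuous there, then `x ↦ polLimit F j (ℰ x)
  ρ bV μ ν z` is continuous on `s` AND is the limit at every `x ∈ s` — the printed limit (1.21) EXISTS there (`continuousOn_
  polLimit_of_tendstoUniformlyOn`, `tendsto_polWindow_polLimit_…`, `polLimitExists_…`; dag-ref-D READ-CARDS v0.9).
* §5 COMPOSITION: N26's literal at the record's β ⇐ [finite-volume termwise continuity + uniform convergence of (1.21) on a box]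
  + [uniform (5.10) decay of the limit kernel on that box] (`n26lit_betaOfTerms_of_finiteVolume`).
* §6 CONSISTENCY OF THE HYPOTHESIS LISTS (audit A2 only; HONESTY LABEL: the ZERO remainder family `ℰ¹ ≡ 0` — the WRONG term
  family for Bałaban, no discharge reads through it): `polScalar_zero`, `polWindow_zero`, `polLimit_zero`, `hypotheses_satisfiable_zeroFamily`.

HONEST FRAMING.  Bookkeeping by name over landed definitions and theorems; NO estimate of Bałaban's series is proved; the term
families `ℰ⁰, ℰ¹` are PARAMETERS (Stage ₈ (a)–(c) not landed); for Bałaban's remainder family every hypothesis of §2–§5 is a located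
input of NODE O ∕ row (D4) (instance 0∕1) and N26 stays VACATED in the discharge form of record (closes WITH N25).  One finite
four-torus programme at fixed ε per run; NOT ℝ⁴, NOT infinite volume, NOT OS, NOT a mass gap, NOT Clay.  Sources (context): [I] =
Balaban1987RG1 (1.7) p. 261, (1.20)–(1.22) p. 264, (2.12)–(2.14) p. 268, (5.10) p. 293; [II] = Balaban1988RG2Cluster Lemma 3 (2.38) p. 20.
-/

noncomputable section

namespace Summit.QuantumFields.YangMills.Theorems.BalabanUVNodesN26Record

open Literature.MathematicalPhysics.QuantumFieldTheory.Balaban1983to89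
open Literature.MathematicalPhysics.QuantumFieldTheory.Balaban1983to89.FlowStep
open Literature.MathematicalPhysics.QuantumFieldTheory.Balaban1983to89.FlowStepRuns (histBox_of_mem_box)
open Literature.MathematicalPhysics.QuantumFieldTheory.Balaban1983to89.T4Continuum (T4Family)
open Literature.MathematicalPhysics.QuantumFieldTheory.Balaban1983to89.Node00
open Literature.MathematicalPhysics.QuantumFieldTheory.Balaban1983to89.B13ScaleTransfer (Pt)
open Literature.MathematicalPhysics.QuantumFieldTheory.Balaban1983to89.Beta.RemainderChain (RemainderConst)
open Literature.MathematicalPhysics.QuantumFieldTheory.Balaban1983to89.Beta.RemainderChainLattice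
open Literature.MathematicalPhysics.QuantumFieldTheory.Balaban1983to89.Beta.RemainderLimitTorus (LDom limKernel)
open Literature.MathematicalPhysics.QuantumFieldTheory.Balaban1983to89.Beta.RemainderDecay190
open Literature.MathematicalPhysics.QuantumFieldTheory.Balaban1983to89.Beta.RemainderDecay190HoloChain
open Literature.MathematicalPhysics.QuantumFieldTheory.Balaban1983to89.Beta.RemainderLocalityHolo (PolLeavesTFac190H)
open Literature.MathematicalPhysics.QuantumFieldTheory.Balaban1983to89.Beta.BetaContinuity (continuousOn_secondMoment)
open Summit.QuantumFields.BalabanUV.Gaps.BetaContFromD4Chain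
open Filter Topology

variable {𝔄 : Type*} [NormedRing 𝔄] [NormedAlgebra ℝ 𝔄]
variable {V : Type*} [NormedAddCommGroup V] [NormedSpace ℝ V] {ι : Type*} [Fintype ι]

/-! ## §1 What B4 IS at the β-functions of record -/

section Unfold

variable (F : T4Family) (ℰ0 : TermFamily0 F 𝔄) (ℰ1 : TermFamily1 F 𝔄) (ρ : V →L[ℝ] 𝔄) (bV : Module.Basis ι ℝ V)

/-- **B4 at the β of record, two-family design** ([I] (1.22) with the split (2.12)–(2.14)): on every box `]0,γc]^{k+1}` with
`γc ≤ γ`, joint continuity of `betaOfTerms F ℰ⁰ ℰ¹ ρ bV γ` IS continuity in the history of the remainder's second moment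
`β¹_{k+1} = beta1OfTerms F ℰ¹ ρ bV k` (the one-loop number `β⁰_{k+1}` is history-free by typing; the box indicator is `1` there). -/
theorem betaContH_betaOfTerms_iff {γ γc : ℝ} (hle : γc ≤ γ) :
    BetaContH γc (betaOfTerms F ℰ0 ℰ1 ρ bV γ) ↔ ∀ k, ContinuousOn (beta1OfTerms F ℰ1 ρ bV k) (Box γc k) := by
  refine ⟨fun h k => ?_, fun h k => ?_⟩
  · have h1 : ContinuousOn (fun p => betaOfTerms F ℰ0 ℰ1 ρ bV γ k p - beta0OfTerms F ℰ0 ρ bV k) (Box γc k) :=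
      (h k).sub continuousOn_const
    exact h1.congr fun p hp => by
      show beta1OfTerms F ℰ1 ρ bV k p = betaOfTerms F ℰ0 ℰ1 ρ bV γ k p - beta0OfTerms F ℰ0 ρ bV k
      rw [betaOfTerms_of_mem F ℰ0 ℰ1 ρ bV γ (box_mono hle k hp)]; ring
  · exact ((continuousOn_const (c := beta0OfTerms F ℰ0 ρ bV k)).add (h k)).congr fun p hp =>
      betaOfTerms_of_mem F ℰ0 ℰ1 ρ bV γ (box_mono hle k hp)

/-- **B4 at the β of record, design (β)** (one merged term family; `betaOfMerged βm β⁰ γ = β⁰ + 𝟙_box·(βm − β⁰)`): on every box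
`γc ≤ γ`, `BetaContH γc (betaOfMerged βm β⁰ γ)` IS continuity of the merged β `βm` on that box. [cite: Balaban1987RG1, (1.22) p.264] -/
theorem betaContH_betaOfMerged_iff (βm : HBeta) (β0 : ℕ → ℝ) {γ γc : ℝ} (hle : γc ≤ γ) :
    BetaContH γc (betaOfMerged βm β0 γ) ↔ ∀ k, ContinuousOn (βm k) (Box γc k) :=
  ⟨fun h k => (h k).congr fun _ hp => (betaOfMerged_of_mem βm β0 γ (box_mono hle k hp)).symm,
    fun h k => (h k).congr fun _ hp => betaOfMerged_of_mem βm β0 γ (box_mono hle k hp)⟩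

/-- B4 on a box restricts to every smaller box (`FlowStep.box_mono`; = gen 0's `betaContH_of_le`, kept private here). -/
private theorem betaContH_mono {β : HBeta} {γ γ' : ℝ} (h : BetaContH γ β) (hle : γ' ≤ γ) : BetaContH γ' β :=
  fun k => (h k).mono (box_mono hle k)

/-- **N26's LITERAL AT THE β OF RECORD, UNFOLDED**: for `γ > 0`, `∃ γc > 0, BetaContH γc (betaOfTerms F ℰ⁰ ℰ¹ ρ bV γ)` ⇔ on SOME
box `0 < γc ≤ γ` the remainder's second moment `p ↦ Σ_z Π¹_{k+1}(p; z) z₀z₁` of the limit kernel (1.21) is continuous in the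
history, at every scale.  (A box `γc > γ` would straddle the convention's indicator and is never needed: B4 shrinks.) -/
theorem n26lit_betaOfTerms_iff {γ : ℝ} (hγ : 0 < γ) :
    (∃ γc : ℝ, 0 < γc ∧ BetaContH γc (betaOfTerms F ℰ0 ℰ1 ρ bV γ)) ↔
      ∃ γc : ℝ, 0 < γc ∧ γc ≤ γ ∧ ∀ k, ContinuousOn
        (fun p : Fin (k + 1) → ℝ => B12Beta.secondMoment (polLimit F (k + 1) (fun K => ℰ1 k p K) ρ bV) 0 1)
          (Box γc k) := by
  refine ⟨fun ⟨γc, hγc, h⟩ => ⟨min γc γ, lt_min hγc hγ, min_le_right _ _, ?_⟩,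
    fun ⟨γc, hγc, hle, h⟩ => ⟨γc, hγc, (betaContH_betaOfTerms_iff F ℰ0 ℰ1 ρ bV hle).2 h⟩⟩
  exact (betaContH_betaOfTerms_iff F ℰ0 ℰ1 ρ bV (min_le_right γc γ)).1 (betaContH_mono h (min_le_left γc γ))

end Unfold

/-! ## §2 The chain-free road: (C-pt) for the limit kernel + uniform (5.10) decay on the box (M-test BY NAME) -/

section MTest

variable (F : T4Family) (ℰ0 : TermFamily0 F 𝔄) (ℰ1 : TermFamily1 F 𝔄) (ρ : V →L[ℝ] 𝔄) (bV : Module.Basis ι ℝ V)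

/-- **B4 AT THE β OF RECORD ⇐ (C-pt) + uniform (5.10)** (two-family design): if for every scale `k` and every site `z` the limit
kernel `p ↦ Π¹_{k+1}(p; z) = polLimit F (k+1) (ℰ¹ k p ·) ρ bV 0 1 z` is continuous in the history on the box `]0,γc]^{k+1}`, and at
every scale `|Π¹_{k+1}(p; z)| ≤ C_k e^{−δ_{1,k}|z|₁}` with constants uniform in `p` on that box, then `BetaContH γc (betaOfTerms …)`
(`γc ≤ γ`) — `Beta.BetaContinuity.continuousOn_secondMoment` (Weierstrass M-test on `ℤ⁴`) BY NAME.  Both clauses are located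
inputs for Bałaban's ℰ¹ ([I] p. 264 after (1.22): smooth in `g_j` with bounded derivatives; (5.10) p. 293), never asserted.
[cite: Balaban1987RG1, (1.22) p.264 and (5.10) p.293] -/
theorem betaContH_betaOfTerms_of_kernel {γ γc : ℝ} (hle : γc ≤ γ)
    (hcont : ∀ k (z : Fin 4 → ℤ), ContinuousOn
      (fun p : Fin (k + 1) → ℝ => polLimit F (k + 1) (fun K => ℰ1 k p K) ρ bV 0 1 z) (Box γc k))
    (hdec : ∀ k, ∃ C δ₁ : ℝ, 0 < δ₁ ∧ ∀ p ∈ Box γc k,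
      B12Sec2to5.Decay510 (polLimit F (k + 1) (fun K => ℰ1 k p K) ρ bV 0 1) C δ₁) :
    BetaContH γc (betaOfTerms F ℰ0 ℰ1 ρ bV γ) :=
  (betaContH_betaOfTerms_iff F ℰ0 ℰ1 ρ bV hle).2 fun k => by
    obtain ⟨C, δ₁, hδ, hd⟩ := hdec k
    exact continuousOn_secondMoment (fun p : Fin (k + 1) → ℝ => polLimit F (k + 1) (fun K => ℰ1 k p K) ρ bV) 0 1 hδ
      (hcont k) hd

/-- **N26's literal at the β of record from the two kernel clauses on one box `0 < γc ≤ γ`.**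
[cite: Balaban1987RG1, (1.22) p.264 and (5.10) p.293] -/
theorem n26lit_betaOfTerms_of_kernel {γ γc : ℝ} (hγc : 0 < γc) (hle : γc ≤ γ)
    (hcont : ∀ k (z : Fin 4 → ℤ), ContinuousOn
      (fun p : Fin (k + 1) → ℝ => polLimit F (k + 1) (fun K => ℰ1 k p K) ρ bV 0 1 z) (Box γc k))
    (hdec : ∀ k, ∃ C δ₁ : ℝ, 0 < δ₁ ∧ ∀ p ∈ Box γc k,
      B12Sec2to5.Decay510 (polLimit F (k + 1) (fun K => ℰ1 k p K) ρ bV 0 1) C δ₁) :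
    ∃ γc : ℝ, 0 < γc ∧ BetaContH γc (betaOfTerms F ℰ0 ℰ1 ρ bV γ) :=
  ⟨γc, hγc, betaContH_betaOfTerms_of_kernel F ℰ0 ℰ1 ρ bV hle hcont hdec⟩

/-- **Design (β) twin**: B4 at `betaOfMerged (betaMerged F ℰ ρ bV) β⁰ γ` on the box `γc ≤ γ` ⇐ (C-pt) for the limit kernel of the
MERGED family `ℰ` + its (5.10) decay uniform in the history on the box — here the decay clause is LITERALLY the printed (5.10)
p. 293 (stated for the full kernel `Π_{μν}`), read uniformly in the suppressed history (p. 298). [cite: Balaban1987RG1, (1.22) p.264 and (5.10) p.293] -/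
theorem betaContH_betaOfMerged_of_kernel (ℰ : TermFamily1 F 𝔄) (β0 : ℕ → ℝ) {γ γc : ℝ} (hle : γc ≤ γ)
    (hcont : ∀ k (z : Fin 4 → ℤ), ContinuousOn
      (fun p : Fin (k + 1) → ℝ => polLimit F (k + 1) (fun K => ℰ k p K) ρ bV 0 1 z) (Box γc k))
    (hdec : ∀ k, ∃ C δ₁ : ℝ, 0 < δ₁ ∧ ∀ p ∈ Box γc k,
      B12Sec2to5.Decay510 (polLimit F (k + 1) (fun K => ℰ k p K) ρ bV 0 1) C δ₁) :
    BetaContH γc (betaOfMerged (betaMerged F ℰ ρ bV) β0 γ) :=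
  (betaContH_betaOfMerged_iff (betaMerged F ℰ ρ bV) β0 hle).2 fun k => by
    obtain ⟨C, δ₁, hδ, hd⟩ := hdec k
    exact continuousOn_secondMoment (fun p : Fin (k + 1) → ℝ => polLimit F (k + 1) (fun K => ℰ k p K) ρ bV) 0 1 hδ
      (hcont k) hd

end MTest

/-! ## §3 The rows-(D4) ∧ B4 residue AT THE RECORD'S DEFINITIONAL SPLIT from the (1.7) leaves — the (D4) socket at `D₀`'s β -/

section Chain

variable (F : T4Family) (ℰ0 : TermFamily0 F 𝔄) (ℰ1 : TermFamily1 F 𝔄) (ρ : V →L[ℝ] 𝔄) (bV : Module.Basis ι ℝ V)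
variable {γ γ₀ : ℝ} {M : ℕ} [NeZero M] {c : B13.Consts} {ℓ α₂ : ℝ} {q : Consts190}

/-- **`AtSlopeCont` AT THE RECORD'S SPLIT — the (D4)-chain inhabitant for `oneLoopSplit_betaOfTerms` BY NAME.**  Inputs, all
declared: the box `γ₀ ≤ γ`; leaf kernels `A1 k p : LDom 4 → Pt 4 → ℝ` per scale and history (NODE O's (1.7) data); `hrep` — the
LOCALIZED REPRESENTATION OF THE LIMIT KERNEL (1.21) of the remainder family in the channel `(0, 1)`:
`polLimit F (k+1) (ℰ¹ k p ·) ρ bV 0 1 z = Σ'_Y A¹_{k+1}(p; Y, z)` on the box ([I] p. 264 «This limit exists by the localized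
representation (1.7)» — a theorem of [I]∕[II] for Bałaban's family, here a hypothesis); `hleaves` — the [II]-(2.38) ∕ (190) ∕
(1.7) ∕ (4.4) leaves `PolLeavesTFac190H 4 M (A1 k p) c ℓ α₂ q` on the box (NODE A ∕ B ∕ D3); the side conditions `CondsL`,
`R22gen`, `Consts190.Valid`, `SignsL`; smallness `ε₁·K_rem,L ≤ s`; and (C-pt) for the limit kernel on the box.  THEN the chain
`ChainTFac190H 4 M 0 1 (oneLoopSplit_betaOfTerms F ℰ⁰ ℰ¹ ρ bV γ) γ₀ c ℓ α₂ q` is INHABITED — its field `beta1_eq` is DISCHARGED by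
the Stage-₈ definition (`β¹ = 𝟙_box · Σ_z Π¹ z₀z₁`) and `hrep`, `leaves := hleaves` — and carries `CPt` (through `hrep`), so
`Gaps.BetaContFromD4Chain.atSlopeCont_of_chainTFac190H` gives the residue.  For Bałaban's ℰ¹: instance 0∕1, nothing discharged.
[cite: Balaban1987RG1, (1.7) p.261 and (1.20)-(1.22) p.264; Balaban1988RG2Cluster, Lemma 3 (2.38) p.20] -/
theorem atSlopeCont_betaOfTerms (hle : γ₀ ≤ γ) {s : ℝ} (A1 : (k : ℕ) → (Fin (k + 1) → ℝ) → LDom 4 → Pt 4 → ℝ)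
    (hrep : ∀ k (p : Fin (k + 1) → ℝ), p ∈ Box γ₀ k → ∀ z : Pt 4,
      polLimit F (k + 1) (fun K => ℰ1 k p K) ρ bV 0 1 z = limKernel (A1 k p) z)
    (hleaves : ∀ k (p : Fin (k + 1) → ℝ), p ∈ Box γ₀ k → PolLeavesTFac190H 4 M (A1 k p) c ℓ α₂ q)
    (hC : CondsL 4 c ℓ) (h22 : c.R22gen ℓ) (hq : q.Valid c.δ₀) (hs : SignsL c α₂ q.B₃)
    (hsmall : c.ε₁ * remCoeffL 4 M c α₂ q.B₃ ≤ s)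
    (hcont : ∀ k (z : Pt 4), ContinuousOn
      (fun p : Fin (k + 1) → ℝ => polLimit F (k + 1) (fun K => ℰ1 k p K) ρ bV 0 1 z) (Box γ₀ k)) :
    AtSlopeCont (oneLoopSplit_betaOfTerms F ℰ0 ℰ1 ρ bV γ) γ₀ s := by
  let R : ChainTFac190H 4 M 0 1 (oneLoopSplit_betaOfTerms F ℰ0 ℰ1 ρ bV γ) γ₀ c ℓ α₂ q :=
    { A1 := A1
      beta1_eq := fun k p hp => by
        have hp' : p ∈ Box γ₀ k := (histBox_eq_box γ₀ k) ▸ hp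
        show (Box γ k).indicator (beta1OfTerms F ℰ1 ρ bV k) p = _
        rw [Set.indicator_of_mem (box_mono hle k hp')]
        show B12Beta.secondMoment _ 0 1 = B12Beta.secondMoment _ 0 1
        unfold B12Beta.secondMoment
        exact tsum_congr fun z => by rw [hrep k p hp' z]
      leaves := fun k p hp => hleaves k p ((histBox_eq_box γ₀ k) ▸ hp) }
  exact atSlopeCont_of_chainTFac190H R hC h22 hq hs hsmall fun k z =>
    (hcont k z).congr fun p hp => (hrep k p hp z).symm

/-- **B4 ON THE BOX `γ₀` AT THE β OF RECORD from the same located inputs, no smallness clause** (B4 does not read `ε₁·K_rem,L ≤ s`: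
take `s := ε₁·K_rem,L` in `atSlopeCont_betaOfTerms`, then `Gaps.BetaContFromD4Chain.betaContH_of_atSlopeCont` BY NAME).
[cite: Balaban1987RG1, (1.22) p.264 and (5.10) p.293; Balaban1988RG2Cluster, Lemma 3 (2.38) p.20] -/
theorem betaContH_betaOfTerms_of_localizedRep (hle : γ₀ ≤ γ)
    (A1 : (k : ℕ) → (Fin (k + 1) → ℝ) → LDom 4 → Pt 4 → ℝ)
    (hrep : ∀ k (p : Fin (k + 1) → ℝ), p ∈ Box γ₀ k → ∀ z : Pt 4,
      polLimit F (k + 1) (fun K => ℰ1 k p K) ρ bV 0 1 z = limKernel (A1 k p) z)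
    (hleaves : ∀ k (p : Fin (k + 1) → ℝ), p ∈ Box γ₀ k → PolLeavesTFac190H 4 M (A1 k p) c ℓ α₂ q)
    (hC : CondsL 4 c ℓ) (h22 : c.R22gen ℓ) (hq : q.Valid c.δ₀) (hs : SignsL c α₂ q.B₃)
    (hcont : ∀ k (z : Pt 4), ContinuousOn
      (fun p : Fin (k + 1) → ℝ => polLimit F (k + 1) (fun K => ℰ1 k p K) ρ bV 0 1 z) (Box γ₀ k)) :
    BetaContH γ₀ (betaOfTerms F ℰ0 ℰ1 ρ bV γ) :=
  betaContH_of_atSlopeCont (atSlopeCont_betaOfTerms F ℰ0 ℰ1 ρ bV hle A1 hrep hleaves hC h22 hq hs le_rfl hcont)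

/-- **N26's LITERAL AT THE β OF RECORD from the (D4) socket's located inputs + (C-pt) + `0 < γ₀ ≤ γ`** (`γc := γ₀`).
[cite: Balaban1987RG1, (1.22) p.264 and (5.10) p.293; Balaban1988RG2Cluster, Lemma 3 (2.38) p.20] -/
theorem n26lit_betaOfTerms_of_localizedRep (hγ₀ : 0 < γ₀) (hle : γ₀ ≤ γ)
    (A1 : (k : ℕ) → (Fin (k + 1) → ℝ) → LDom 4 → Pt 4 → ℝ)
    (hrep : ∀ k (p : Fin (k + 1) → ℝ), p ∈ Box γ₀ k → ∀ z : Pt 4,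
      polLimit F (k + 1) (fun K => ℰ1 k p K) ρ bV 0 1 z = limKernel (A1 k p) z)
    (hleaves : ∀ k (p : Fin (k + 1) → ℝ), p ∈ Box γ₀ k → PolLeavesTFac190H 4 M (A1 k p) c ℓ α₂ q)
    (hC : CondsL 4 c ℓ) (h22 : c.R22gen ℓ) (hq : q.Valid c.δ₀) (hs : SignsL c α₂ q.B₃)
    (hcont : ∀ k (z : Pt 4), ContinuousOn
      (fun p : Fin (k + 1) → ℝ => polLimit F (k + 1) (fun K => ℰ1 k p K) ρ bV 0 1 z) (Box γ₀ k)) :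
    ∃ γc : ℝ, 0 < γc ∧ BetaContH γc (betaOfTerms F ℰ0 ℰ1 ρ bV γ) :=
  ⟨γ₀, hγ₀, betaContH_betaOfTerms_of_localizedRep F ℰ0 ℰ1 ρ bV hle A1 hrep hleaves hC h22 hq hs hcont⟩

/-- **The wall's constant form at the record's split**: the same inputs with smallness give `RemainderConst
(oneLoopSplit_betaOfTerms …) γ₀ s` — `|β¹_{k+1}(p)| ≤ s` on the boxes — through `remainderConst_of_atSlopeCont` (the currency
N25's END reads at `s := stepBal N Lc`). [cite: Balaban1988RG2Cluster, Lemma 3 (2.38) p.20; Balaban1987RG1, (1.22) p.264] -/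
theorem remainderConst_betaOfTerms_of_localizedRep (hle : γ₀ ≤ γ) {s : ℝ}
    (A1 : (k : ℕ) → (Fin (k + 1) → ℝ) → LDom 4 → Pt 4 → ℝ)
    (hrep : ∀ k (p : Fin (k + 1) → ℝ), p ∈ Box γ₀ k → ∀ z : Pt 4,
      polLimit F (k + 1) (fun K => ℰ1 k p K) ρ bV 0 1 z = limKernel (A1 k p) z)
    (hleaves : ∀ k (p : Fin (k + 1) → ℝ), p ∈ Box γ₀ k → PolLeavesTFac190H 4 M (A1 k p) c ℓ α₂ q)
    (hC : CondsL 4 c ℓ) (h22 : c.R22gen ℓ) (hq : q.Valid c.δ₀) (hs : SignsL c α₂ q.B₃)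
    (hsmall : c.ε₁ * remCoeffL 4 M c α₂ q.B₃ ≤ s)
    (hcont : ∀ k (z : Pt 4), ContinuousOn
      (fun p : Fin (k + 1) → ℝ => polLimit F (k + 1) (fun K => ℰ1 k p K) ρ bV 0 1 z) (Box γ₀ k)) :
    RemainderConst (oneLoopSplit_betaOfTerms F ℰ0 ℰ1 ρ bV γ) γ₀ s :=
  remainderConst_of_atSlopeCont
    (atSlopeCont_betaOfTerms F ℰ0 ℰ1 ρ bV hle A1 hrep hleaves hC h22 hq hs hsmall hcont)

end Chain

/-! ## §4 (C-pt) of the limit kernel (1.21) from the finite-volume kernels: uniform convergence on a parameter set -/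

section Limit

variable (F : T4Family) (ρ : V →L[ℝ] 𝔄) (bV : Module.Basis ι ℝ V)
variable {X : Type*} [TopologicalSpace X] {s : Set X} {j : ℕ}

/-- **Termwise continuity of the limit kernel from finite volume** ([folklore]; the uniform limit of continuous functions is
continuous): if the windowed kernels `K ↦ polWindow F K j (ℰ x K) ρ bV μ ν z` of a parameter-dependent family of term functionals
converge UNIFORMLY for `x ∈ s` to some `g`, and are eventually continuous on `s`, then `x ↦ polLimit F j (ℰ x) ρ bV μ ν z` is
continuous on `s` (and equals `g` there: `polLimit` IS the limit where it exists, `Node00.polLimit_eq_of_tendsto`). -/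
theorem continuousOn_polLimit_of_tendstoUniformlyOn
    (ℰ : X → (K : ℕ) → (Fin (F.P K).d → Site (F.P K) j → 𝔄) → ℝ) {μ ν : Fin 4} {z : Fin 4 → ℤ} {g : X → ℝ}
    (hU : TendstoUniformlyOn (fun K x => polWindow F K j (ℰ x K) ρ bV μ ν z) g atTop s)
    (hK : ∀ᶠ K in atTop, ContinuousOn (fun x => polWindow F K j (ℰ x K) ρ bV μ ν z) s) :
    ContinuousOn (fun x => polLimit F j (ℰ x) ρ bV μ ν z) s :=
  (hU.continuousOn hK.frequently).congr fun x hx => polLimit_eq_of_tendsto F j (ℰ x) ρ bV (hU.tendsto_at hx)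

omit [TopologicalSpace X] in
/-- Under the same uniform convergence the printed limit (1.21) EXISTS at every parameter of `s` and `polLimit` IS it: the
finite-volume kernels converge to `polLimit F j (ℰ x) ρ bV μ ν z`. [cite: Balaban1987RG1, (1.21) p.264] -/
theorem tendsto_polWindow_polLimit_of_tendstoUniformlyOn
    (ℰ : X → (K : ℕ) → (Fin (F.P K).d → Site (F.P K) j → 𝔄) → ℝ) {μ ν : Fin 4} {z : Fin 4 → ℤ} {g : X → ℝ}
    (hU : TendstoUniformlyOn (fun K x => polWindow F K j (ℰ x K) ρ bV μ ν z) g atTop s) {x : X} (hx : x ∈ s) :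
    Tendsto (fun K : ℕ => polWindow F K j (ℰ x K) ρ bV μ ν z) atTop (𝓝 (polLimit F j (ℰ x) ρ bV μ ν z)) := by
  rw [polLimit_eq_of_tendsto F j (ℰ x) ρ bV (hU.tendsto_at hx)]
  exact hU.tendsto_at hx

omit [TopologicalSpace X] in
/-- Hence NODE 00's named existence property `PolLimitExists F j (ℰ x) ρ bV` at every `x ∈ s`, when the convergence is uniform on
`s` in every channel and at every site. [cite: Balaban1987RG1, (1.21) p.264] -/
theorem polLimitExists_of_tendstoUniformlyOn
    (ℰ : X → (K : ℕ) → (Fin (F.P K).d → Site (F.P K) j → 𝔄) → ℝ)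
    (hU : ∀ (μ ν : Fin 4) (z : Fin 4 → ℤ), ∃ g : X → ℝ,
      TendstoUniformlyOn (fun K x => polWindow F K j (ℰ x K) ρ bV μ ν z) g atTop s) {x : X} (hx : x ∈ s) :
    PolLimitExists F j (ℰ x) ρ bV := fun μ ν z => by
  obtain ⟨g, hg⟩ := hU μ ν z
  exact ⟨g x, hg.tendsto_at hx⟩

end Limit

/-! ## §5 Composition: N26's literal at the β of record from finite-volume inputs + uniform decay of the limit kernel -/

section Compose

variable (F : T4Family) (ℰ0 : TermFamily0 F 𝔄) (ℰ1 : TermFamily1 F 𝔄) (ρ : V →L[ℝ] 𝔄) (bV : Module.Basis ι ℝ V)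

/-- **N26 AT THE β OF RECORD FROM FINITE VOLUME**: on one box `0 < γc ≤ γ`, (i) the finite-volume remainder kernels
`p ↦ polWindow F K (k+1) (ℰ¹ k p K) ρ bV 0 1 z` are eventually continuous in the history and converge uniformly on the box as
`K → ∞` (the limit (1.21), locally uniformly in the suppressed history), for every scale and site; (ii) the limit kernel obeys
(5.10) with constants uniform on the box, per scale ⟹ `∃ γc > 0, BetaContH γc (betaOfTerms F ℰ⁰ ℰ¹ ρ bV γ)`.  §4 ∘ §2.  Every
clause a located input for Bałaban's ℰ¹; nothing discharged. [cite: Balaban1987RG1, (1.21)-(1.22) p.264 and (5.10) p.293] -/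
theorem n26lit_betaOfTerms_of_finiteVolume {γ γc : ℝ} (hγc : 0 < γc) (hle : γc ≤ γ)
    (hU : ∀ k (z : Fin 4 → ℤ), ∃ g : (Fin (k + 1) → ℝ) → ℝ,
      TendstoUniformlyOn (fun K p => polWindow F K (k + 1) (ℰ1 k p K) ρ bV 0 1 z) g atTop (Box γc k))
    (hK : ∀ k (z : Fin 4 → ℤ), ∀ᶠ K in atTop,
      ContinuousOn (fun p : Fin (k + 1) → ℝ => polWindow F K (k + 1) (ℰ1 k p K) ρ bV 0 1 z) (Box γc k))
    (hdec : ∀ k, ∃ C δ₁ : ℝ, 0 < δ₁ ∧ ∀ p ∈ Box γc k,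
      B12Sec2to5.Decay510 (polLimit F (k + 1) (fun K => ℰ1 k p K) ρ bV 0 1) C δ₁) :
    ∃ γc : ℝ, 0 < γc ∧ BetaContH γc (betaOfTerms F ℰ0 ℰ1 ρ bV γ) := by
  refine n26lit_betaOfTerms_of_kernel F ℰ0 ℰ1 ρ bV hγc hle (fun k z => ?_) hdec
  obtain ⟨g, hg⟩ := hU k z
  exact continuousOn_polLimit_of_tendstoUniformlyOn F ρ bV (fun (p : Fin (k + 1) → ℝ) K => ℰ1 k p K) hg (hK k z)

end Compose

/-! ## §6 Consistency of the hypothesis lists (audit A2 only) — the ZERO remainder family; HONESTY LABEL: the wrong family for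
Bałaban (no remainder at all), a satisfiability check of the typed hypotheses, NOT an instance; counts unmoved -/

section Satisfiable

variable (F : T4Family) (ρ : V →L[ℝ] 𝔄) (bV : Module.Basis ι ℝ V)

/-- The scalar polarisation kernel (1.20)–(1.21)₁ of the ZERO functional vanishes (the Hessian of a constant is `0`).
[folklore] -/
theorem polScalar_zero {Λ T : Type*} [Fintype Λ] [Fintype T] [DecidableEq Λ] [DecidableEq T]
    (μ : Λ) (x : T) (ν : Λ) (y : T) : polScalar (fun _ : Λ → T → 𝔄 => (0 : ℝ)) ρ bV μ x ν y = 0 := by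
  have h0 : B12PolarizationTensor120.expChart (fun _ : Λ → T → 𝔄 => (0 : ℝ)) ρ = fun _ => 0 := funext fun _ => rfl
  have hc : ∀ a b : ι, B12PolarizationTensor120.polComp ℝ
      (B12PolarizationTensor120.expChart (fun _ : Λ → T → 𝔄 => (0 : ℝ)) ρ) bV μ x a ν y b = 0 := by
    intro a b
    unfold B12PolarizationTensor120.polComp B12PolarizationTensor120.polTensor
    rw [h0, fderiv_fun_const]
    show (fderiv ℝ (fun _ : Λ → T → V => (0 : (Λ → T → V) →L[ℝ] ℝ)) 0) _ _ = 0
    rw [fderiv_fun_const]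
    simp
  simp [polScalar, hc]

/-- Hence the windowed finite-volume kernel of the ZERO term functional vanishes. [folklore] -/
theorem polWindow_zero (K j : ℕ) (μ ν : Fin 4) (z : Fin 4 → ℤ) :
    polWindow F K j (fun _ : Fin (F.P K).d → Site (F.P K) j → 𝔄 => (0 : ℝ)) ρ bV μ ν z = 0 :=
  polScalar_zero ρ bV _ _ _ _

/-- Hence its limit kernel (1.21) vanishes too (`limUnder` of a constant sequence). [folklore] -/
theorem polLimit_zero (j : ℕ) (μ ν : Fin 4) (z : Fin 4 → ℤ) :
    polLimit F j (fun K => fun _ : Fin (F.P K).d → Site (F.P K) j → 𝔄 => (0 : ℝ)) ρ bV μ ν z = 0 :=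
  polLimit_eq_of_tendsto F j _ ρ bV (by simpa only [polWindow_zero] using tendsto_const_nhds)

/-- **A2: the hypothesis lists of §2 and §5 are jointly satisfiable** — at the ZERO remainder family `ℰ¹ ≡ 0` (any `ℰ⁰`): the
finite-volume kernels are `0` (continuous, uniformly convergent), the limit kernel is `0` ((C-pt) trivially, (5.10) with `C = 0`),
and the conclusion holds on every box `0 < γc ≤ γ`.  HONESTY LABEL: `ℰ¹ ≡ 0` is NOT Bałaban's remainder (2.13) — this certifies only
that the typed hypotheses are not contradictory; the instance count for Bałaban's family stays 0∕1. -/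
theorem hypotheses_satisfiable_zeroFamily (ℰ0 : TermFamily0 F 𝔄) {γ γc : ℝ} (hγc : 0 < γc) (hle : γc ≤ γ) :
    let ℰ1 : TermFamily1 F 𝔄 := fun _ _ _ _ => 0
    (∀ k (z : Fin 4 → ℤ), ∃ g : (Fin (k + 1) → ℝ) → ℝ,
      TendstoUniformlyOn (fun K p => polWindow F K (k + 1) (ℰ1 k p K) ρ bV 0 1 z) g atTop (Box γc k)) ∧
    (∀ k (z : Fin 4 → ℤ), ∀ᶠ K in atTop,
      ContinuousOn (fun p : Fin (k + 1) → ℝ => polWindow F K (k + 1) (ℰ1 k p K) ρ bV 0 1 z) (Box γc k)) ∧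
    (∀ k, ∃ C δ₁ : ℝ, 0 < δ₁ ∧ ∀ p ∈ Box γc k,
      B12Sec2to5.Decay510 (polLimit F (k + 1) (fun K => ℰ1 k p K) ρ bV 0 1) C δ₁) ∧
    ∃ γc : ℝ, 0 < γc ∧ BetaContH γc (betaOfTerms F ℰ0 ℰ1 ρ bV γ) := by
  intro ℰ1
  have hW : ∀ K k (p : Fin (k + 1) → ℝ) (z : Fin 4 → ℤ), polWindow F K (k + 1) (ℰ1 k p K) ρ bV 0 1 z = 0 :=
    fun K k p z => polWindow_zero F ρ bV K (k + 1) 0 1 z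
  have hL : ∀ k (p : Fin (k + 1) → ℝ), polLimit F (k + 1) (fun K => ℰ1 k p K) ρ bV 0 1 = fun _ => 0 :=
    fun k p => funext fun z => polLimit_zero F ρ bV (k + 1) 0 1 z
  have hU : ∀ k (z : Fin 4 → ℤ), ∃ g : (Fin (k + 1) → ℝ) → ℝ,
      TendstoUniformlyOn (fun K p => polWindow F K (k + 1) (ℰ1 k p K) ρ bV 0 1 z) g atTop (Box γc k) :=
    fun k z => ⟨fun _ => 0, by
      simp only [hW]
      exact (tendsto_const_nhds (x := (0 : ℝ))).tendstoUniformlyOn_const (Box γc k)⟩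
  have hK : ∀ k (z : Fin 4 → ℤ), ∀ᶠ K in atTop,
      ContinuousOn (fun p : Fin (k + 1) → ℝ => polWindow F K (k + 1) (ℰ1 k p K) ρ bV 0 1 z) (Box γc k) :=
    fun k z => Eventually.of_forall fun K => by simp only [hW]; exact continuousOn_const
  have hdec : ∀ k, ∃ C δ₁ : ℝ, 0 < δ₁ ∧ ∀ p ∈ Box γc k,
      B12Sec2to5.Decay510 (polLimit F (k + 1) (fun K => ℰ1 k p K) ρ bV 0 1) C δ₁ :=
    fun k => ⟨0, 1, one_pos, fun p _ => by
      rw [hL k p]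
      intro z
      simp⟩
  exact ⟨hU, hK, hdec, n26lit_betaOfTerms_of_finiteVolume F ℰ0 ℰ1 ρ bV hγc hle hU hK hdec⟩

end Satisfiable

end Summit.QuantumFields.YangMills.Theorems.BalabanUVNodesN26Record

end
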